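import Literature.AlgebraicGeometry.HodgeTheory.HomComplexPullback
import Literature.AlgebraicGeometry.Modules.SheafHomPullbackIso
import Literature.AlgebraicGeometry.Modules.PullbackDual
import HarnessLib

/-!
# The Hom complex along a pull-back is an ISOMORPHISM for vector-bundle sources: `f^*•𝓗om•(E•, L•) ≅ 𝓗om•(f^*•E•, f^*•L•)`, and the
# derived-dual chain isomorphism `f^*•(E•^∨) ≅ (f^*•E•)^∨`, `E•^∨ := 𝓗om•(E•, 𝒪[0])`

Layer `Literature/AlgebraicGeometry/HodgeTheory`; namespace `Literature.AlgebraicGeometry.HodgeTheory`. THEOREMS only (no definition, no named fact, no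
instance): the isomorphism half of `HomComplexPullback.homComplexPullbackHom` (p684166, the comparison morphism for ALL `E•`, `L•`), for cochain complexes
`E•` WITH FINITE LOCALLY FREE TERMS and arbitrary `L•`, along ANY morphism of schemes `f` — summand by summand the module-level isomorphism
`isIso_sheafHomPullbackComparison` (`Modules/SheafHomPullbackIso`, p685351: `f^*𝓗om(A, M) ≅ 𝓗om(f^*A, f^*M)` for `A` finite locally free, Görtz–Wedhorn I
Ex. 7.20 (a)), glued through Mathlib's total complex (`HomologicalComplex₂.total.mapIso`).

* `isIso_homBicomplexPullbackHom` — the bicomplex comparison is an isomorphism (componentwise);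
* **`isIso_homComplexPullbackHom`** — `IsIso (homComplexPullbackHom f E L)` for `E•` with finite locally free terms, any `L•`; `nonempty_pullback_homComplex_iso`.
* **`nonempty_pullback_dualComplexUnit_iso`** — the DERIVED-DUAL CHAIN ISOMORPHISM: with `E•^∨ := 𝓗om•(E•, 𝒪_Y[0])`,
  `f^*•(E•^∨) ≅ 𝓗om•(f^*•E•, 𝒪_X[0]) = (f^*•E•)^∨` (the previous item at `L = 𝒪[0]`, then `f^*𝒪_Y ≅ 𝒪_X`, `Modules.pullbackUnitComparison`, moved into the second
  argument by the functoriality `HomComplex.map`).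

Use (Hodge programme, road №4, crux 26512, route «2T» step (iii), dual half, probe (N-5)(β) of prover-26512-2T-i): the typable half of
`J(E•^∨) = J(E•)⁻¹`; the other half is the derived-duality anti-equivalence on perfect complexes, NOT in the tree. Library only — proves nothing about (N-U), 26512,
№4, HC_AV or HC.

## References

* U. Görtz, T. Wedhorn, *Algebraic Geometry I* (2nd ed. 2020), (7.8.3) and Exercise 7.20 (a). [GortzWedhorn2020]
* The Stacks Project, *More on Algebra*, Section «Hom complexes»; Tag 01CM. [StacksProject]
* C. A. Weibel, *An introduction to homological algebra* (1994), §1.2 (1.2.6), 2.7.4–2.7.5. [Weibel1994]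
-/

noncomputable section

open CategoryTheory CategoryTheory.Limits AlgebraicGeometry HomologicalComplex₂

universe u

namespace Literature.AlgebraicGeometry.HodgeTheory

open Literature.AlgebraicGeometry.Modules Literature.AlgebraicGeometry.Motives

variable {X Y : Scheme.{u}} (f : X ⟶ Y) (E L : CochainComplex Y.Modules ℤ)

/-- **The bicomplex comparison is an isomorphism when every `Eⁱ` is finite locally free** (componentwise `isIso_sheafHomPullbackComparison`).
[cite: GortzWedhorn2020, Exercise 7.20 (a) with (7.8.3)] -/
theorem isIso_homBicomplexPullbackHom (hE : ∀ i, IsFiniteLocallyFree (E.X i)) : IsIso (homBicomplexPullbackHom f E L) := by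
  haveI : ∀ q, IsIso ((homBicomplexPullbackHom f E L).f q) := fun q => by
    haveI : ∀ i, IsIso (((homBicomplexPullbackHom f E L).f q).f i) := fun i => by
      rw [homBicomplexPullbackHom_f_f]
      exact isIso_sheafHomPullbackComparison f (hE (-i)) (L.X q)
    exact HomologicalComplex.Hom.isIso_of_components _
  exact HomologicalComplex.Hom.isIso_of_components _

/-- **`f^*•𝓗om•(E•, L•) ⟶ 𝓗om•(f^*•E•, f^*•L•)` IS AN ISOMORPHISM for `E•` with finite locally free terms** (any `L•`, any `f`): `f^*` preserves the total complex's
coproducts (`mapTotalIso`) and the bicomplex comparison is an isomorphism. [cite: GortzWedhorn2020, Exercise 7.20 (a) with (7.8.3)] [cite: Weibel1994, §1.2, 1.2.6 and 2.7.4–2.7.5] -/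
theorem isIso_homComplexPullbackHom (hE : ∀ i, IsFiniteLocallyFree (E.X i)) : IsIso (homComplexPullbackHom f E L) := by
  haveI := isIso_homBicomplexPullbackHom f E L hE
  haveI : IsIso (HomologicalComplex₂.total.map (homBicomplexPullbackHom f E L) (ComplexShape.up ℤ)) :=
    (HomologicalComplex₂.total.mapIso (asIso (homBicomplexPullbackHom f E L)) (ComplexShape.up ℤ)).isIso_hom
  unfold homComplexPullbackHom
  infer_instance

/-- `f^*•𝓗om•(E•, L•) ≅ 𝓗om•(f^*•E•, f^*•L•)` (`Nonempty` form). [cite: GortzWedhorn2020, Exercise 7.20 (a) with (7.8.3)] -/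
theorem nonempty_pullback_homComplex_iso (hE : ∀ i, IsFiniteLocallyFree (E.X i)) :
    Nonempty (((Scheme.Modules.pullback f).mapHomologicalComplex (ComplexShape.up ℤ)).obj (homComplex Y E L) ≅
      homComplex X (((Scheme.Modules.pullback f).mapHomologicalComplex (ComplexShape.up ℤ)).obj E)
        (((Scheme.Modules.pullback f).mapHomologicalComplex (ComplexShape.up ℤ)).obj L)) :=
  haveI := isIso_homComplexPullbackHom f E L hE
  ⟨asIso (homComplexPullbackHom f E L)⟩

/-- `𝓗om•(E•, –)` carries isomorphisms of complexes to isomorphisms (functoriality of the Hom cochain complex in the second argument, `HomComplex.map_comp` ∕ `map_id`).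
[cite: Weibel1994, 2.7.4–2.7.5 (Hom cochain complex)] -/
theorem isIso_homComplex_map (E' : CochainComplex X.Modules ℤ) {F F' : CochainComplex X.Modules ℤ} (φ : F ⟶ F') [IsIso φ] :
    IsIso (HomComplex.map X E' φ) :=
  ⟨HomComplex.map X E' (inv φ), by rw [← HomComplex.map_comp, IsIso.hom_inv_id, HomComplex.map_id],
    by rw [← HomComplex.map_comp, IsIso.inv_hom_id, HomComplex.map_id]⟩

/-- **`f^*•(𝒪_Y[0]) ≅ 𝒪_X[0]`**: `f^*𝒪_Y ≅ 𝒪_X` (`Modules.pullbackUnitComparison`, Stacks 01AK) in degree `0` (Mathlib `singleMapHomologicalComplex`). [cite: StacksProject, Tag 01AK] -/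
theorem nonempty_pullback_single_unitModule_iso :
    Nonempty (((Scheme.Modules.pullback f).mapHomologicalComplex (ComplexShape.up ℤ)).obj
        ((HomologicalComplex.single Y.Modules (ComplexShape.up ℤ) 0).obj (unitModule Y)) ≅
      (HomologicalComplex.single X.Modules (ComplexShape.up ℤ) 0).obj (unitModule X)) :=
  haveI := isIso_pullbackUnitComparison f
  ⟨((HomologicalComplex.singleMapHomologicalComplex (Scheme.Modules.pullback f) (ComplexShape.up ℤ) 0).app (unitModule Y)) ≪≫
    (HomologicalComplex.single X.Modules (ComplexShape.up ℤ) 0).mapIso (asIso (pullbackUnitComparison f))⟩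

/-- **THE DERIVED-DUAL CHAIN ISOMORPHISM `f^*•(E•^∨) ≅ (f^*•E•)^∨`**, `E•^∨ := 𝓗om•(E•, 𝒪[0])`, for `E•` with finite locally free terms and any morphism `f`:
`f^*•𝓗om•(E•, 𝒪_Y[0]) ≅ 𝓗om•(f^*•E•, f^*•𝒪_Y[0]) ≅ 𝓗om•(f^*•E•, 𝒪_X[0])`. (The dual of a pulled-back vector-bundle complex is the pull-back of the dual; the typable
half of `J(E•^∨) = J(E•)⁻¹` on an abelian variety — the other half is derived duality on perfect complexes, not in the tree.)
[cite: GortzWedhorn2020, Exercise 7.20 (a) with (7.8.3)] [cite: StacksProject, Tag 01AK and Tag 01CM] -/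
theorem nonempty_pullback_dualComplexUnit_iso (hE : ∀ i, IsFiniteLocallyFree (E.X i)) :
    Nonempty (((Scheme.Modules.pullback f).mapHomologicalComplex (ComplexShape.up ℤ)).obj
        (homComplex Y E ((HomologicalComplex.single Y.Modules (ComplexShape.up ℤ) 0).obj (unitModule Y))) ≅
      homComplex X (((Scheme.Modules.pullback f).mapHomologicalComplex (ComplexShape.up ℤ)).obj E)
        ((HomologicalComplex.single X.Modules (ComplexShape.up ℤ) 0).obj (unitModule X))) := by
  obtain ⟨e₁⟩ := nonempty_pullback_homComplex_iso f E ((HomologicalComplex.single Y.Modules (ComplexShape.up ℤ) 0).obj (unitModule Y)) hE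
  obtain ⟨e₂⟩ := nonempty_pullback_single_unitModule_iso f
  haveI := isIso_homComplex_map (((Scheme.Modules.pullback f).mapHomologicalComplex (ComplexShape.up ℤ)).obj E) e₂.hom
  exact ⟨e₁ ≪≫ asIso (HomComplex.map X (((Scheme.Modules.pullback f).mapHomologicalComplex (ComplexShape.up ℤ)).obj E) e₂.hom)⟩

end Literature.AlgebraicGeometry.HodgeTheory

end
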